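import Mathlib.Combinatorics.SimpleGraph.Maps
import Literature.Computability.Complexity.FoldCatBricks
import Literature.Computability.Complexity.UnaryOffsets
import Literature.Computability.Complexity.GraphEncodings
import HarnessLib

/-!
# Graph swap bricks: the adjacent transposition `(i i+1)` on adjacency-matrix codes is in `FP`

Trunk `CplxCore`, toolkit in the `FP` string-algebra style of `BrickAlgebra.lean` /
`FoldCatBricks.lean` (records, `fanoutFn`, `iteFn`, `takeFn`/`dropFn`, the concatenation fold
`Brick.foldCat`), written for the Chen–Flum construction of a logic for PTIME from a p-optimal
proof system (`ModelTheory/FiniteModelTheory/POptimalAndLogicsForPTIMEProofs.lean`), where the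
NP-witnesses of NON-invariance of a clocked program are pairs (bit matrix, adjacent transposition).

* `GraphSwap.tau i` — the transposition `(i i+1)` on `ℕ`; `GraphSwap.rowOf n r M` — row `r` of a
  row-major `n`-column bit matrix; `GraphSwap.exchAt i ρ` — a row with positions `i`, `i+1`
  exchanged; **`GraphSwap.swapMat i n M`** — the row-major code of `P M Pᵀ` for the permutation
  matrix `P` of `(i i+1)`: row `r` of the result is `exchAt i (rowOf n (tau i r) M)`.
* `GraphSwap.getD_swapMat` — its entries: `(swapMat i n M)[r n + c] = M[τ r · n + τ c]`;
  `GraphSwap.swapMat_swapMat` — it is an involution on `n × n` matrices.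
* **`GraphSwap.encode_comap_swap`** — for a simple graph `G` on `Fin n` and `i + 1 < n`, the
  adjacency code (`encodingGraphFin`, row-major, `GraphEncodings.lean`) of the relabelled graph
  `G.comap (Equiv.swap i (i+1))` is `swapMat i n (code of G)`.
* **`GraphSwap.swapMatFn ∈ FP`** with `swapMatFn ⟨M, ⟨1ⁿ, 1ⁱ⟩⟩ = swapMat i n M` on EVERY bit
  string `M` (`swapMatFn_apply`): a `foldCat` over the rows whose piece function is assembled from
  `takeFn`/`dropFn`/`take1Fn`, the unary product `UnaryOffsets.mulLenFn` (row offsets `r · n`)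
  and two equality tests (`eqPairFn`) selecting the row index `τ r`.

## References

* S. Arora, B. Barak, *Computational Complexity: A Modern Approach*, CUP 2009, §0.1 (adjacency
  matrix codes), §1.3 (polynomial time is closed under composition and bounded loops).
* Y. Chen, J. Flum, *On p-optimal proof systems and logics for PTIME*, ICALP 2010, LNCS 6199,
  proof of Lemma 9 (the NP language `Q` of non-invariance witnesses).
-/

namespace Literature.Computability.Complexity

open _root_.Computability Polynomial Brick Plumb

namespace GraphSwap

/-! ### The transposition on indices, rows, and the swapped matrix -/

/-- The adjacent transposition `(i i+1)` as a map on `ℕ`. [folklore] -/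
def tau (i r : ℕ) : ℕ := if r = i then i + 1 else if r = i + 1 then i else r

/-- `tau i` is an involution. [folklore] -/
@[simp] theorem tau_tau (i r : ℕ) : tau i (tau i r) = r := by
  unfold tau; split_ifs <;> omega

/-- `tau i` maps `[0, n)` to itself when `i + 1 < n`. [folklore] -/
theorem tau_lt {i r n : ℕ} (hi : i + 1 < n) (hr : r < n) : tau i r < n := by
  unfold tau; split_ifs <;> omega

/-- On `Fin n`, `tau i` is the value of `Equiv.swap ⟨i, _⟩ ⟨i+1, _⟩`. [folklore] -/
theorem swap_apply_val {n i : ℕ} (hi : i + 1 < n) (r : Fin n) :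
    ((Equiv.swap (⟨i, by omega⟩ : Fin n) ⟨i + 1, hi⟩) r : ℕ) = tau i r := by
  rw [Equiv.swap_apply_def]
  unfold tau
  split_ifs with h1 h2 h3 h4 <;> simp_all [Fin.ext_iff]

/-- Row `r` of a row-major bit matrix with `n` columns. [folklore] -/
def rowOf (n r : ℕ) (M : List Bool) : List Bool := (M.drop (r * n)).take n

/-- A row with its entries `i`, `i + 1` exchanged:
`ρ↾i ++ ρ[i+1] ++ ρ[i] ++ ρ⇂(i+2)` (in terms of `take`/`drop`). [folklore] -/
def exchAt (i : ℕ) (ρ : List Bool) : List Bool :=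
  ρ.take i ++ ((ρ.drop (i + 1)).take 1 ++ ((ρ.drop i).take 1 ++ ρ.drop (i + 2)))

/-- **The swapped matrix** `swapMat i n M`: rows `exchAt i (rowOf n (tau i r) M)`, `r < n`,
concatenated (`ccat` of `EncodingFrames.lean`), i.e. the row-major code of `(P M Pᵀ)` for the
permutation matrix of `(i i+1)`. [folklore] -/
def swapMat (i n : ℕ) (M : List Bool) : List Bool :=
  ccat (fun r => exchAt i (rowOf n (tau i r) M)) n

/-! ### Entries -/

/-- Length of a full row. [folklore] -/
theorem length_rowOf {n r : ℕ} {M : List Bool} (h : (r + 1) * n ≤ M.length) :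
    (rowOf n r M).length = n := by
  simp only [rowOf, List.length_take, List.length_drop]
  have : (r + 1) * n = r * n + n := by ring
  omega

/-- Entries of a row. [folklore] -/
theorem getD_rowOf {n r c : ℕ} (M : List Bool) (hc : c < n) :
    (rowOf n r M).getD c false = M.getD (r * n + c) false := by
  simp only [rowOf, List.getD_eq_getElem?_getD, List.getElem?_take, if_pos hc, List.getElem?_drop]

/-- Length of an exchanged row. [folklore] -/
theorem length_exchAt {i : ℕ} {ρ : List Bool} (hi : i + 2 ≤ ρ.length) :
    (exchAt i ρ).length = ρ.length := by
  simp only [exchAt, List.length_append, List.length_take, List.length_drop]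
  omega

/-- Length of an exchanged row, in general: at most two more symbols. [folklore] -/
theorem length_exchAt_le (i : ℕ) (ρ : List Bool) : (exchAt i ρ).length ≤ ρ.length + 2 := by
  simp only [exchAt, List.length_append, List.length_take, List.length_drop]
  omega

/-- Entries of an exchanged row: `(exchAt i ρ)[c] = ρ[tau i c]`. [folklore] -/
theorem getD_exchAt {i c : ℕ} {ρ : List Bool} (hi : i + 2 ≤ ρ.length) (hc : c < ρ.length) :
    (exchAt i ρ).getD c false = ρ.getD (tau i c) false := by
  have hl1 : (ρ.take i).length = i := by simp; omega
  have hl2 : ((ρ.drop (i + 1)).take 1).length = 1 := by simp; omega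
  have hl3 : ((ρ.drop i).take 1).length = 1 := by simp; omega
  simp only [exchAt, List.getD_eq_getElem?_getD]
  rcases Nat.lt_or_ge c i with h | h
  · rw [List.getElem?_append_left (by omega), List.getElem?_take, if_pos h]
    simp [tau, show c ≠ i by omega, show c ≠ i + 1 by omega]
  rw [List.getElem?_append_right (by omega), hl1]
  rcases Nat.lt_or_ge c (i + 1) with h1 | h1
  · have hc' : c = i := by omega
    subst hc'
    rw [List.getElem?_append_left (by omega), List.getElem?_take, if_pos (by omega),
      List.getElem?_drop]
    simp [tau]
  rw [List.getElem?_append_right (by omega), hl2]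
  rcases Nat.lt_or_ge c (i + 2) with h2 | h2
  · have hc' : c = i + 1 := by omega
    subst hc'
    rw [List.getElem?_append_left (by omega), List.getElem?_take, if_pos (by omega),
      List.getElem?_drop]
    simp [tau]
  rw [List.getElem?_append_right (by omega), hl3, List.getElem?_drop]
  have ht : tau i c = c := by unfold tau; rw [if_neg (by omega), if_neg (by omega)]
  rw [ht]
  congr 2
  omega

/-- `ccat` of `n` pieces of length `n` has length `n * n`. [folklore] -/
theorem length_ccat_eq {g : ℕ → List Bool} {n : ℕ} (h : ∀ r, r < n → (g r).length = n) :
    ∀ k, k ≤ n → (ccat g k).length = k * n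
  | 0, _ => by simp
  | k + 1, hk => by
    rw [ccat_succ, List.length_append, length_ccat_eq h k (by omega), h k (by omega)]; ring

/-- Entries of a `ccat` of pieces of length `n`: `(ccat g k)[r n + c] = (g r)[c]`. [folklore] -/
theorem getD_ccat {g : ℕ → List Bool} {n : ℕ} (h : ∀ r, r < n → (g r).length = n) :
    ∀ k, k ≤ n → ∀ {r c : ℕ}, r < k → c < n →
      (ccat g k).getD (r * n + c) false = (g r).getD c false
  | 0, _, r, c, hr, _ => absurd hr (Nat.not_lt_zero _)
  | k + 1, hk, r, c, hr, hc => by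
    rw [ccat_succ, List.getD_eq_getElem?_getD, List.getD_eq_getElem?_getD]
    have hlen := length_ccat_eq h k (by omega)
    rcases Nat.lt_or_ge r k with hrk | hrk
    · have hlt : r * n + c < (ccat g k).length := by
        rw [hlen]; calc r * n + c < r * n + n := by omega
          _ = (r + 1) * n := by ring
          _ ≤ k * n := Nat.mul_le_mul_right _ hrk
      rw [List.getElem?_append_left hlt, ← List.getD_eq_getElem?_getD, ← List.getD_eq_getElem?_getD]
      exact getD_ccat h k (by omega) hrk hc
    · have hrk' : r = k := by omega
      subst hrk'
      rw [List.getElem?_append_right (by rw [hlen]; omega), hlen]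
      congr 2
      omega

/-- **Length of the swapped matrix**: `n * n` on an `n × n` matrix (`i + 1 < n`). [folklore] -/
theorem length_swapMat {i n : ℕ} {M : List Bool} (hi : i + 1 < n) (hM : M.length = n * n) :
    (swapMat i n M).length = n * n := by
  refine length_ccat_eq (fun r hr => ?_) n le_rfl
  have hrow : (rowOf n (tau i r) M).length = n :=
    length_rowOf (by rw [hM]; exact Nat.mul_le_mul_right _ (tau_lt hi hr))
  rw [length_exchAt (by rw [hrow]; omega), hrow]

/-- **Entries of the swapped matrix**: `(swapMat i n M)[r n + c] = M[τ r · n + τ c]`. [folklore] -/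
theorem getD_swapMat {i n : ℕ} {M : List Bool} (hi : i + 1 < n) (hM : M.length = n * n)
    {r c : ℕ} (hr : r < n) (hc : c < n) :
    (swapMat i n M).getD (r * n + c) false = M.getD (tau i r * n + tau i c) false := by
  have hrow : ∀ r, r < n → (rowOf n (tau i r) M).length = n := fun r hr =>
    length_rowOf (by rw [hM]; exact Nat.mul_le_mul_right _ (tau_lt hi hr))
  have hlen : ∀ r, r < n → (exchAt i (rowOf n (tau i r) M)).length = n := fun r hr => by
    rw [length_exchAt (by rw [hrow r hr]; omega), hrow r hr]
  rw [swapMat, getD_ccat hlen n le_rfl hr hc, getD_exchAt (by rw [hrow r hr]; omega)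
    (by rw [hrow r hr]; exact hc), getD_rowOf _ (tau_lt hi hc)]

/-- Two bit strings of the same length `n * n` with the same entries are equal. [folklore] -/
theorem ext_matrix {n : ℕ} {A B : List Bool} (hA : A.length = n * n) (hB : B.length = n * n)
    (h : ∀ r c, r < n → c < n → A.getD (r * n + c) false = B.getD (r * n + c) false) : A = B := by
  refine List.ext_getElem (hA.trans hB.symm) fun k h1 h2 => ?_
  have hn : 0 < n := Nat.pos_of_ne_zero fun h0 => by subst h0; simp at hA; omega
  have hk := h (k / n) (k % n) (by
      rw [Nat.div_lt_iff_lt_mul hn]; rwa [hA] at h1) (Nat.mod_lt _ hn)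
  rw [Nat.div_add_mod' k n] at hk
  rw [List.getD_eq_getElem?_getD, List.getD_eq_getElem?_getD, List.getElem?_eq_getElem h1,
    List.getElem?_eq_getElem h2] at hk
  simpa using hk

/-- **`swapMat i n` is an involution on `n × n` matrices.** [folklore] -/
theorem swapMat_swapMat {i n : ℕ} {M : List Bool} (hi : i + 1 < n) (hM : M.length = n * n) :
    swapMat i n (swapMat i n M) = M := by
  have h1 := length_swapMat hi hM
  refine ext_matrix (length_swapMat hi h1) hM fun r c hr hc => ?_
  rw [getD_swapMat hi h1 hr hc, getD_swapMat hi hM (tau_lt hi hr) (tau_lt hi hc), tau_tau, tau_tau]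

/-! ### The code of the relabelled graph -/

/-- Entries of the adjacency code of `GraphEncodings.encodingGraphFin` (row-major):
bit `r n + c` is `[G.Adj r c]`. [Arora–Barak 2009, §0.1] [cite: AroraBarak2009, §0.1] -/
theorem getD_encode_iff {n : ℕ} (G : SimpleGraph (Fin n)) {r c : ℕ} (hr : r < n) (hc : c < n) :
    ((encodingGraphFin n).encode G).getD (r * n + c) false = true ↔ G.Adj ⟨r, hr⟩ ⟨c, hc⟩ := by
  classical
  have hk : r * n + c < n * n := by
    calc r * n + c < r * n + n := by omega
      _ = (r + 1) * n := by ring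
      _ ≤ n * n := Nat.mul_le_mul_right _ hr
  have hn : 0 < n := by omega
  simp only [encodingGraphFin, encodingBitVec, List.getD_eq_getElem?_getD, List.getElem?_ofFn,
    hk, dite_true, Option.getD_some, finProdFinEquiv_symm_apply, decide_eq_true_eq]
  have h1 : ((⟨r * n + c, hk⟩ : Fin (n * n)).divNat : Fin n) = ⟨r, hr⟩ := by
    apply Fin.ext
    show (r * n + c) / n = r
    rw [Nat.add_comm, Nat.add_mul_div_right _ _ hn, Nat.div_eq_of_lt hc, Nat.zero_add]
  have h2 : ((⟨r * n + c, hk⟩ : Fin (n * n)).modNat : Fin n) = ⟨c, hc⟩ := by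
    apply Fin.ext
    show (r * n + c) % n = c
    rw [Nat.add_comm, Nat.add_mul_mod_self_right, Nat.mod_eq_of_lt hc]
  rw [h1, h2]

/-- Length of the adjacency code. [Arora–Barak 2009, §0.1] [cite: AroraBarak2009, §0.1] -/
@[simp] theorem length_encode {n : ℕ} (G : SimpleGraph (Fin n)) :
    ((encodingGraphFin n).encode G).length = n * n := by
  classical
  simp [encodingGraphFin, encodingBitVec]

/-- **The code of the relabelled graph is the swapped matrix**: for `i + 1 < n`, the adjacency
code of `G.comap (i i+1)` (whose adjacency is `G.Adj (τ r) (τ c)`) is `swapMat i n (code G)`.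
[Arora–Barak 2009, §0.1 (adjacency-matrix representation)] [cite: AroraBarak2009, §0.1] -/
theorem encode_comap_swap {n i : ℕ} (hi : i + 1 < n) (G : SimpleGraph (Fin n)) :
    (encodingGraphFin n).encode
        (G.comap (Equiv.swap (⟨i, by omega⟩ : Fin n) ⟨i + 1, hi⟩)) =
      swapMat i n ((encodingGraphFin n).encode G) := by
  refine ext_matrix (length_encode _) (length_swapMat hi (length_encode G)) fun r c hr hc => ?_
  rw [getD_swapMat hi (length_encode G) hr hc]
  apply Bool.eq_iff_iff.2
  rw [getD_encode_iff _ hr hc, getD_encode_iff G (tau_lt hi hr) (tau_lt hi hc),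
    SimpleGraph.comap_adj]
  have h1 : (Equiv.swap (⟨i, by omega⟩ : Fin n) ⟨i + 1, hi⟩) ⟨r, hr⟩ = ⟨tau i r, tau_lt hi hr⟩ :=
    Fin.ext (swap_apply_val hi _)
  have h2 : (Equiv.swap (⟨i, by omega⟩ : Fin n) ⟨i + 1, hi⟩) ⟨c, hc⟩ = ⟨tau i c, tau_lt hi hc⟩ :=
    Fin.ext (swap_apply_val hi _)
  simp only [h1, h2]

/-! ### The brick `swapMatFn` -/

/-- `ones a = ones b ↔ a = b`. [folklore] -/
theorem ones_inj {a b : ℕ} : ones a = ones b ↔ a = b :=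
  ⟨fun h => by simpa using congrArg List.length h, fun h => h ▸ rfl⟩

/-- `ones r = 1 :: ones i ↔ r = i + 1`. [folklore] -/
theorem ones_eq_true_cons_ones {r i : ℕ} : ones r = true :: ones i ↔ r = i + 1 := by
  rw [show true :: ones i = ones (i + 1) by simp [ones, List.replicate_succ], ones_inj]

/-- Equality tests after a map are one-bit conditions. [folklore] -/
theorem oneBit_eqPairFn_comp (g : List Bool → List Bool) : OneBit (eqPairFn ∘ g) := fun z => by
  rcases eqPairFn_eq_or (g z) with h | h <;> exact ⟨_, h⟩

/-- The matrix `M` of a piece record `⟨⟨M, ⟨1ⁿ, 1ⁱ⟩⟩, 1ʳ⟩`. [folklore] -/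
noncomputable def pM : List Bool → List Bool := fstF ∘ fstF

/-- The side `1ⁿ` of a piece record. [folklore] -/
noncomputable def pN : List Bool → List Bool := nthF 1 ∘ fstF

/-- The position `1ⁱ` of a piece record. [folklore] -/
noncomputable def pI : List Bool → List Bool := sndPow 1 ∘ fstF

/-- `pM ∈ FP`. [folklore] -/
theorem pM_mem_FP : pM ∈ FP := comp_mem_FP fstF_mem_FP fstF_mem_FP

/-- `pN ∈ FP`. [folklore] -/
theorem pN_mem_FP : pN ∈ FP := comp_mem_FP (nthF_mem_FP 1) fstF_mem_FP

/-- `pI ∈ FP`. [folklore] -/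
theorem pI_mem_FP : pI ∈ FP := comp_mem_FP (sndPow_mem_FP 1) fstF_mem_FP

/-- `pM` on a piece record. [folklore] -/
@[simp] theorem pM_rec (M u v w : List Bool) : pM (boolPair (boolPair M (boolPair u v)) w) = M := by
  simp [pM]

/-- `pN` on a piece record. [folklore] -/
@[simp] theorem pN_rec (M u v w : List Bool) : pN (boolPair (boolPair M (boolPair u v)) w) = u := by
  simp [pN]

/-- `pI` on a piece record. [folklore] -/
@[simp] theorem pI_rec (M u v w : List Bool) : pI (boolPair (boolPair M (boolPair u v)) w) = v := by
  simp [pI]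

/-- **The row at a unary index**: `rowAtFn s z = take n (drop (|s z| · n) M)`, the offset being the
length of `mulLenFn ⟨s z, 1ⁿ⟩`. [folklore] -/
noncomputable def rowAtFn (s : List Bool → List Bool) : List Bool → List Bool :=
  takeFn ∘ fanoutFn pN (dropFn ∘ fanoutFn (UnaryOffsets.mulLenFn ∘ fanoutFn s pN) pM)

/-- `rowAtFn s ∈ FP` for `s ∈ FP`. [cite: AroraBarak2009, §1.3] -/
theorem rowAtFn_mem_FP {s : List Bool → List Bool} (hs : s ∈ FP) : rowAtFn s ∈ FP :=
  comp_mem_FP takeFn_mem_FP (fanoutFn_mem_FP pN_mem_FP (comp_mem_FP dropFn_mem_FP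
    (fanoutFn_mem_FP (comp_mem_FP UnaryOffsets.mulLenFn_mem_FP (fanoutFn_mem_FP hs pN_mem_FP))
      pM_mem_FP)))

/-- Value of `rowAtFn` on a piece record. [folklore] -/
theorem rowAtFn_rec (s : List Bool → List Bool) (M w : List Bool) (n i : ℕ) :
    rowAtFn s (boolPair (boolPair M (boolPair (ones n) (ones i))) w) =
      rowOf n (s (boolPair (boolPair M (boolPair (ones n) (ones i))) w)).length M := by
  simp [rowAtFn, rowOf]

/-- **The row `τ r`** of a piece record: two equality tests select the index. [folklore] -/
noncomputable def rowTauFn : List Bool → List Bool :=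
  iteFn (eqPairFn ∘ fanoutFn sndF pI) (rowAtFn (List.cons true ∘ pI))
    (iteFn (eqPairFn ∘ fanoutFn sndF (List.cons true ∘ pI)) (rowAtFn pI) (rowAtFn sndF))

/-- `rowTauFn ∈ FP`. [cite: AroraBarak2009, §1.3] -/
theorem rowTauFn_mem_FP : rowTauFn ∈ FP :=
  iteFn_mem_FP (comp_mem_FP eqPairFn_mem_FP (fanoutFn_mem_FP sndF_mem_FP pI_mem_FP))
    (rowAtFn_mem_FP (comp_mem_FP (cons_mem_FP true) pI_mem_FP))
    (iteFn_mem_FP (comp_mem_FP eqPairFn_mem_FP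
      (fanoutFn_mem_FP sndF_mem_FP (comp_mem_FP (cons_mem_FP true) pI_mem_FP)))
      (rowAtFn_mem_FP pI_mem_FP) (rowAtFn_mem_FP sndF_mem_FP))

/-- Value of `rowTauFn` on a piece record. [folklore] -/
theorem rowTauFn_rec (M : List Bool) (n i r : ℕ) :
    rowTauFn (boolPair (boolPair M (boolPair (ones n) (ones i))) (ones r)) = rowOf n (tau i r) M := by
  rw [rowTauFn, iteFn_of_oneBit (oneBit_eqPairFn_comp _)]
  simp only [Function.comp_apply, fanoutFn_apply, sndF_boolPair, pI_rec, eqPairFn_boolPair,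
    ones_inj, List.cons.injEq, decide_eq_true_eq, and_true]
  by_cases h1 : r = i
  · rw [if_pos h1, rowAtFn_rec]
    subst h1
    simp [tau]
  rw [if_neg h1, iteFn_of_oneBit (oneBit_eqPairFn_comp _)]
  simp only [Function.comp_apply, fanoutFn_apply, sndF_boolPair, pI_rec, eqPairFn_boolPair,
    ones_eq_true_cons_ones, List.cons.injEq, decide_eq_true_eq, and_true]
  by_cases h2 : r = i + 1
  · rw [if_pos h2, rowAtFn_rec]
    subst h2
    simp [tau]
  rw [if_neg h2, rowAtFn_rec]
  simp [tau, h1, h2]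

/-- **The piece**: `exchAt i (row τ r)`, spelt with `takeFn`/`dropFn`/`take1Fn`. [folklore] -/
noncomputable def pieceFn : List Bool → List Bool := fun z =>
  (takeFn ∘ fanoutFn pI rowTauFn) z ++
    ((take1Fn ∘ dropFn ∘ fanoutFn (List.cons true ∘ pI) rowTauFn) z ++
      ((take1Fn ∘ dropFn ∘ fanoutFn pI rowTauFn) z ++
        (dropFn ∘ fanoutFn (List.cons true ∘ List.cons true ∘ pI) rowTauFn) z))

/-- `pieceFn ∈ FP`. [cite: AroraBarak2009, §1.3] -/
theorem pieceFn_mem_FP : pieceFn ∈ FP :=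
  append_mem_FP (comp_mem_FP takeFn_mem_FP (fanoutFn_mem_FP pI_mem_FP rowTauFn_mem_FP))
    (append_mem_FP
      (comp_mem_FP take1Fn_mem_FP (comp_mem_FP dropFn_mem_FP
        (fanoutFn_mem_FP (comp_mem_FP (cons_mem_FP true) pI_mem_FP) rowTauFn_mem_FP)))
      (append_mem_FP
        (comp_mem_FP take1Fn_mem_FP (comp_mem_FP dropFn_mem_FP
          (fanoutFn_mem_FP pI_mem_FP rowTauFn_mem_FP)))
        (comp_mem_FP dropFn_mem_FP (fanoutFn_mem_FP
          (comp_mem_FP (cons_mem_FP true) (comp_mem_FP (cons_mem_FP true) pI_mem_FP))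
          rowTauFn_mem_FP))))

/-- Value of the piece on a piece record. [folklore] -/
theorem pieceFn_rec (M : List Bool) (n i r : ℕ) :
    pieceFn (boolPair (boolPair M (boolPair (ones n) (ones i))) (ones r)) =
      exchAt i (rowOf n (tau i r) M) := by
  simp [pieceFn, rowTauFn_rec, exchAt, take1Fn]

/-- The piece is short: at most `n + 2` symbols. [folklore] -/
theorem length_pieceFn_rec_le (M : List Bool) (n i r : ℕ) :
    (pieceFn (boolPair (boolPair M (boolPair (ones n) (ones i))) (ones r))).length ≤ n + 2 := by
  rw [pieceFn_rec]
  refine (length_exchAt_le _ _).trans ?_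
  simp [rowOf]

/-- **The swap brick** `swapMatFn ⟨M, ⟨1ⁿ, 1ⁱ⟩⟩ = swapMat i n M`: the concatenation fold of the
pieces over the `n` rows. [cite: AroraBarak2009, §1.3 (bounded loops)] -/
noncomputable def swapMatFn : List Bool → List Bool :=
  foldCat X X pieceFn ∘ fanoutFn id (nthF 1)

/-- **`swapMatFn ∈ FP`.** [cite: AroraBarak2009, §1.3 (bounded loops)] -/
theorem swapMatFn_mem_FP : swapMatFn ∈ FP :=
  comp_mem_FP (foldCat_mem_FP X X pieceFn_mem_FP)
    (fanoutFn_mem_FP OracleCompose.id_mem_FP (nthF_mem_FP 1))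

/-- **Semantics of the swap brick**, on every bit string `M`. [folklore] -/
theorem swapMatFn_apply (M : List Bool) (n i : ℕ) :
    swapMatFn (boolPair M (boolPair (ones n) (ones i))) = swapMat i n M := by
  rw [swapMatFn, Function.comp_apply, fanoutFn_apply, id, nthF_succ_boolPair, nthF_zero,
    fstF_boolPair, foldCat_apply]
  · simp only [List.length_replicate]
    exact ccat_congr fun r _ => pieceFn_rec M n i r
  · simp [length_boolPair]; omega
  · intro t _
    refine (length_pieceFn_rec_le M n i t).trans ?_
    simp [length_boolPair]; omega

end GraphSwap

end Literature.Computability.Complexity
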